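import Summits.AtomisticToContinuum.FouriersLaw.Theses.BondHeatUncertainty
import Summits.AtomisticToContinuum.FouriersLaw.Theorems.BondHeatUncertaintySubdiffusiveBondHeatBathBondReductionCorrelations

/-!
# Expectations of one-time values and time integrals along the stationary flow (helper 5 for `stub_steadyHeatRates`)

Helper file for crux `stmt-AtomisticToContinuum-9122` (`BondHeatUncertainty.LinearResponseFTUR`), line
`lebesgue-flip-duality`, stub `stub_steadyHeatRates`. For the constructed flow `z_s = Φ_s(x, B(ω))` of the pinned
chain started from a law `μ` INVARIANT for the constructed kernels (`μ.bind P_s = μ`; hypothesis), under `μ ⊗ W`: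

* `pinnedChain_integrable_comp_solMap_of_invariant` — `g(z_s) ∈ L¹` and `E g(z_s) = ∫ g dμ` for `g ∈ L¹(μ)`, `s ≥ 0`
  (one-time law `…FlowLaws.pinnedChain_map_solMap_of_invariant`);
* `integral_comp_fst_prod_wienerPair` — `E g(x) = ∫ g dμ` for the initial point;
* `pinnedChain_measurable_timeIntegral` — `(x, ω) ↦ ∫₀ᵗ g(z_s) ds` is measurable for measurable `g`;
* `pinnedChain_timeIntegral_of_invariant` (registered sub-goal `pinnedChain_timeIntegralMean`) — for `g` measurable with
  `g, g² ∈ L¹(μ)` and `t ≥ 0`: `∫₀ᵗ g(z_s) ds ∈ L¹` and `E ∫₀ᵗ g(z_s) ds = t ∫ g dμ` (Fubini through the sibling's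
  `pinnedChain_integrable_uncurry_pointTime_of_invariant`, then the one-time law at each `s`).

Nothing here closes an item.
-/

noncomputable section

namespace Summit.AtomisticToContinuum.FouriersLaw.Theorems.LinearResponseFTUR

open MeasureTheory ProbabilityTheory Filter Topology Set intervalIntegral
open scoped NNReal ENNReal
open Literature.MathematicalPhysics.KineticTheory.HeatConduction Literature.Probability.Process
open Summit.AtomisticToContinuum.FouriersLaw.Theorems.SubdiffusiveBondHeat

/-- The expectation of a function of the initial point under `μ ⊗ W` is its `μ`-integral. [folklore] -/
theorem integral_comp_fst_prod_wienerPair {N : ℕ} (μ : Measure (PhaseSpace N)) [SFinite μ] (g : PhaseSpace N → ℝ) :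
    ∫ p, g p.1 ∂(μ.prod wienerPair) = ∫ y, g y ∂μ := by
  rw [integral_fun_fst]
  simp

section Flow

variable {ω₂ lam β γ : ℝ} (hω : 0 < ω₂) (hl : 0 ≤ lam) (hβ : 0 ≤ β) (hγ : 0 ≤ γ) (N : ℕ) (T_L T_R : ℝ)
include hω hl hβ hγ

/-- **One-time values along the stationary flow**: for `g ∈ L¹(μ)`, `μ` invariant and every real time `s` (the flow
is clamped to the initial point for `s ≤ 0`): `g(z_s) ∈ L¹(μ ⊗ W)` and `E g(z_s) = ∫ g dμ`. [folklore] -/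
theorem pinnedChain_integrable_comp_solMap_of_invariant (μ : Measure (PhaseSpace N)) [SFinite μ]
    (hinv : ∀ s : ℝ≥0, μ.bind ((pinnedChain ω₂ lam β γ).transitionKernel N T_L T_R s) = μ)
    {g : PhaseSpace N → ℝ} (hg : Integrable g μ) (s : ℝ) :
    Integrable (fun p : PhaseSpace N × WienerPair =>
      g ((pinnedChain ω₂ lam β γ).solMap N T_L T_R s p.1 (pairPath p.2))) (μ.prod wienerPair) ∧
    ∫ p, g ((pinnedChain ω₂ lam β γ).solMap N T_L T_R s p.1 (pairPath p.2)) ∂(μ.prod wienerPair) = ∫ y, g y ∂μ := by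
  -- adapted from `…FlowLaws.pinnedChain_integrable_sq_solMap_of_invariant` (the time is routed through `s⁺`)
  have hm := pinnedChain_measurable_solMap_pairPath hω hl hβ hγ N T_L T_R ((s.toNNReal : ℝ≥0) : ℝ)
  have hlaw := pinnedChain_map_solMap_of_invariant hω hl hβ hγ N T_L T_R μ _ (hinv s.toNNReal)
  have heq : (fun p : PhaseSpace N × WienerPair =>
      g ((pinnedChain ω₂ lam β γ).solMap N T_L T_R s p.1 (pairPath p.2))) =
      g ∘ (fun p => (pinnedChain ω₂ lam β γ).solMap N T_L T_R ((s.toNNReal : ℝ≥0) : ℝ) p.1 (pairPath p.2)) := by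
    funext p
    simp only [Function.comp_apply]
    rw [pinnedChain_solMap_eq_solMap_toNNReal N T_L T_R s]
  have hg' : Integrable g ((μ.prod wienerPair).map
      (fun p => (pinnedChain ω₂ lam β γ).solMap N T_L T_R ((s.toNNReal : ℝ≥0) : ℝ) p.1 (pairPath p.2))) := by
    rw [hlaw]; exact hg
  refine ⟨?_, ?_⟩
  · rw [heq]
    exact (integrable_map_measure hg'.aestronglyMeasurable hm.aemeasurable).1 hg'
  · calc ∫ p, g ((pinnedChain ω₂ lam β γ).solMap N T_L T_R s p.1 (pairPath p.2)) ∂(μ.prod wienerPair)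
        = ∫ p, g ((pinnedChain ω₂ lam β γ).solMap N T_L T_R ((s.toNNReal : ℝ≥0) : ℝ) p.1 (pairPath p.2))
            ∂(μ.prod wienerPair) := by
          refine integral_congr_ae (Eventually.of_forall fun p => ?_)
          simp only
          rw [pinnedChain_solMap_eq_solMap_toNNReal N T_L T_R s]
      _ = ∫ y, g y ∂((μ.prod wienerPair).map
            (fun p => (pinnedChain ω₂ lam β γ).solMap N T_L T_R ((s.toNNReal : ℝ≥0) : ℝ) p.1 (pairPath p.2))) :=
          (integral_map hm.aemeasurable hg'.aestronglyMeasurable).symm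
      _ = ∫ y, g y ∂μ := by rw [hlaw]

/-- The time integral `(x, ω) ↦ ∫₀ᵗ g(z_s) ds` of a measurable observable along the flow is measurable
(`t ≥ 0`). [folklore] -/
theorem pinnedChain_measurable_timeIntegral {g : PhaseSpace N → ℝ} (hg : Measurable g) {t : ℝ} (ht : 0 ≤ t) :
    Measurable fun p : PhaseSpace N × WienerPair =>
      ∫ s in (0 : ℝ)..t, g ((pinnedChain ω₂ lam β γ).solMap N T_L T_R s p.1 (pairPath p.2)) := by
  have hZ := pinnedChain_measurable_solMap_process hω hl hβ hγ N T_L T_R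
  have hF : StronglyMeasurable (Function.uncurry fun (p : PhaseSpace N × WienerPair) (s : ℝ) =>
      g ((pinnedChain ω₂ lam β γ).solMap N T_L T_R s p.1 (pairPath p.2))) := by
    refine Measurable.stronglyMeasurable ?_
    have h1 : Measurable fun w : (PhaseSpace N × WienerPair) × ℝ => (w.2, w.1) := measurable_snd.prodMk measurable_fst
    -- NB: build the composition first, then `exact` (elaborating against the goal unfolds `solMap`)
    have hB := hg.comp (hZ.comp h1)
    exact hB
  have h := hF.integral_prod_right' (ν := (volume : Measure ℝ).restrict (Ioc 0 t))
  have e : (fun p : PhaseSpace N × WienerPair =>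
      ∫ s in (0 : ℝ)..t, g ((pinnedChain ω₂ lam β γ).solMap N T_L T_R s p.1 (pairPath p.2))) =
      fun p => ∫ s in Ioc 0 t, Function.uncurry (fun (p : PhaseSpace N × WienerPair) (s : ℝ) =>
        g ((pinnedChain ω₂ lam β γ).solMap N T_L T_R s p.1 (pairPath p.2))) (p, s) := by
    funext p
    simp only [Function.uncurry]
    rw [integral_of_le ht]
  rw [e]
  exact h.measurable

/-- **Time integrals along the stationary flow** (Fubini + one-time law): for `μ` a probability measure invariant for
the constructed kernels, `g` measurable with `g, g² ∈ L¹(μ)` and `t ≥ 0`: `∫₀ᵗ g(z_s) ds ∈ L¹(μ ⊗ W)` and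
`E_{μ⊗W} ∫₀ᵗ g(z_s) ds = t ∫ g dμ`. [folklore] -/
theorem pinnedChain_timeIntegral_of_invariant (μ : Measure (PhaseSpace N)) [IsProbabilityMeasure μ]
    (hinv : ∀ s : ℝ≥0, μ.bind ((pinnedChain ω₂ lam β γ).transitionKernel N T_L T_R s) = μ)
    {g : PhaseSpace N → ℝ} (hg : Measurable g) (hgi : Integrable g μ) (hg2 : Integrable (fun y => g y ^ 2) μ)
    {t : ℝ} (ht : 0 ≤ t) :
    Integrable (fun p : PhaseSpace N × WienerPair =>
      ∫ s in (0 : ℝ)..t, g ((pinnedChain ω₂ lam β γ).solMap N T_L T_R s p.1 (pairPath p.2))) (μ.prod wienerPair) ∧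
    ∫ p, (∫ s in (0 : ℝ)..t, g ((pinnedChain ω₂ lam β γ).solMap N T_L T_R s p.1 (pairPath p.2)))
        ∂(μ.prod wienerPair) = t * ∫ y, g y ∂μ := by
  have hG := pinnedChain_integrable_uncurry_pointTime_of_invariant hω hl hβ hγ N T_L T_R μ hinv (k := fun _ => (1:ℝ))
    hg measurable_const hg2 (by simp) 0 t
  have hG' : Integrable (Function.uncurry fun (p : PhaseSpace N × WienerPair) (s : ℝ) =>
      g ((pinnedChain ω₂ lam β γ).solMap N T_L T_R s p.1 (pairPath p.2)))
      ((μ.prod wienerPair).prod ((volume : Measure ℝ).restrict (Ioc 0 t))) :=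
    hG.congr (ae_of_all _ fun q => by simp [Function.uncurry])
  refine ⟨?_, ?_⟩
  · refine hG'.integral_prod_left.congr (ae_of_all _ fun p => ?_)
    simp only [Function.uncurry]
    rw [integral_of_le ht]
  · calc ∫ p, (∫ s in (0 : ℝ)..t, g ((pinnedChain ω₂ lam β γ).solMap N T_L T_R s p.1 (pairPath p.2)))
          ∂(μ.prod wienerPair)
        = ∫ p, (∫ s in Ioc 0 t, g ((pinnedChain ω₂ lam β γ).solMap N T_L T_R s p.1 (pairPath p.2)))
            ∂(μ.prod wienerPair) :=
          integral_congr_ae (ae_of_all _ fun p => by simp only; rw [integral_of_le ht])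
      _ = ∫ s in Ioc 0 t, (∫ p, g ((pinnedChain ω₂ lam β γ).solMap N T_L T_R s p.1 (pairPath p.2))
            ∂(μ.prod wienerPair)) := integral_integral_swap hG'
      _ = ∫ s in Ioc 0 t, (∫ y, g y ∂μ) :=
          setIntegral_congr_fun measurableSet_Ioc fun s hs =>
            (pinnedChain_integrable_comp_solMap_of_invariant hω hl hβ hγ N T_L T_R μ hinv hgi s).2
      _ = t * ∫ y, g y ∂μ := by
          rw [setIntegral_const, Real.volume_real_Ioc_of_le ht, smul_eq_mul, sub_zero]

end Flow

/-- **Mean of a time integral along the stationary flow** (registered sub-goal of `stub_steadyHeatRates`; closed form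
of `pinnedChain_timeIntegral_of_invariant`): for the pinned chain (`ω₂ > 0`, `lam, β, γ ≥ 0`), a probability measure
`μ` invariant for the constructed kernels, `g` measurable with `g, g² ∈ L¹(μ)`, and `t ≥ 0`:
`E_{μ⊗W} ∫₀ᵗ g(z_s) ds = t ∫ g dμ`. [folklore] -/
theorem pinnedChain_timeIntegralMean :
    ∀ (ω₂ lam β γ : ℝ), 0 < ω₂ → 0 ≤ lam → 0 ≤ β → 0 ≤ γ → ∀ (N : ℕ) (T_L T_R : ℝ)
    (μ : Measure (PhaseSpace N)) [IsProbabilityMeasure μ],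
    (∀ s : ℝ≥0, μ.bind ((pinnedChain ω₂ lam β γ).transitionKernel N T_L T_R s) = μ) →
    ∀ (g : PhaseSpace N → ℝ), Measurable g → Integrable g μ → Integrable (fun y => g y ^ 2) μ →
    ∀ t : ℝ, 0 ≤ t →
    ∫ p, (∫ s in (0 : ℝ)..t, g ((pinnedChain ω₂ lam β γ).solMap N T_L T_R s p.1 (pairPath p.2)))
        ∂(μ.prod wienerPair) = t * ∫ y, g y ∂μ := by
  intro ω₂ lam β γ hω hl hβ hγ N T_L T_R μ _ hinv g hg hgi hg2 t ht
  exact (pinnedChain_timeIntegral_of_invariant hω hl hβ hγ N T_L T_R μ hinv hg hgi hg2 ht).2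

end Summit.AtomisticToContinuum.FouriersLaw.Theorems.LinearResponseFTUR

end
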